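/-
Origin: expansion seat `prover-pub-hodgecm-mc-binder-1-g15-0`, handover #R102 2026-08-20T19:10:37Z md5 69a2c8c6966f (218 l.; NEW additive universe-free datum-generic (p = 2) leaf; imports #R100 + sinst-1 #1233 Model/BallFormsHecke (PKG, RUN 59); drop-alone below #R100; NAME LIST: HodgeCM.Model.HeckeClassLiftHecke.frameIso_cosetRealPoint · HodgeCM.Model.HeckeClassLiftHecke.map_heckeStabilizer_eq_heckeStab · HodgeCM.Model.HeckeClassLiftHecke.factorPullback_mul_ballRep_of_mem_heckeLevel · HodgeCM.Model.HeckeClassLiftHecke.classLift_heckeOpC_eq_hecke) (`HOME/mc/pub-hodgecm-mc-binder-1-g15/stage60/HodgeCM/Model/HeckeClassLiftHecke.lean`, md5 69a2c8c6966f, 218 lines);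
landed by the second packager p2 gen 12 (p2-g12) in gate run 60 as `HodgeCM/Model/HeckeClassLiftHecke.lean` (verbatim).
-/
/-
Copyright (c) 2026 the pub-hodgecm formalisation cell (harness21).  New file, not vendored.
Origin: session prover-pub-hodgecm-mc-binder-1-g15-0 (unit pub-hodgecm-mc-binder-1-g15, BINDER PROVER gen 15 of lineage mc-binder-1;
content lane (J-Liu-Θ), scope memo `HOME/mc/pub-hodgecm-mc-binder-1-g14/JLIU-THETA-SCOPE.md` §9 (J2), HECKE-TOWER sub-leaf (T8):
«(J2) in the normal form of sinst-1's section-level Hecke operator: `lift (T_g ω) = T_g (lift ω)`»), 2026-08-20.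
Intended final place: `HodgeCM/Model/HeckeClassLiftHecke.lean` (NEW additive leaf, universe-free, datum-generic (p = 2); imports ONLY this lane's
`HodgeCM.Model.HeckeClassLiftRecords` (#R100) and sinst-1's `HodgeCM.Model.BallFormsHecke` (#1233, RUN 59); nothing imports it; drops with either).
-/
import Summits.HodgeConjecture.HodgeCM.Model.HeckeClassLiftRecords
import Summits.HodgeConjecture.HodgeCM.Model.BallFormsHecke

set_option autoImplicit false

/-!
# (J2) in Hecke normal form: `classLift (T_g ω) = T_{g}^{𝔹} (classLift ω)`

The JUNCTION of this lane's cohomological (J2) (`HeckeClassLiftRecords.classLift_heckeOpC`, #R100: `lift (T_g ω) = [Γ':N_g]⁻¹ Σ_{q ∈ Γ/N_g} (g γ̃_q)^* lift ω`)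
with sinst-1's section-level Hecke operator `BallFormsHecke.hecke` (#1233: `T_g F = Tr_{Δ ← Δ ∩ g⁻¹Δg} (g^* F) = Σ (g γ⁻¹)^* F`, with its normalisation
identity `sum_factorPullback_mul_out_eq_relIndex_smul_hecke`).  For a compact ball quotient SURFACE datum `D`, frame `𝔣` (`Δ := D.ballImage 𝔣 ≤ U(2,1)` the
image of `Γ`, `g^𝔣 := frameIso 𝔣 (g^{τ₁}) ∈ U(2,1)` the rational element read in the frame), `g ∈ U(V)(F)` and `ω ∈ F¹H¹(X)`:

  `classLift_heckeOpC_eq_hecke :  D.classLift hHD 𝔣 (T_g ω) = BallFormsHecke.hecke cotangentCocycle Δ g^𝔣 (D.classLift hHD 𝔣 ω)`,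

over the records (ii-a) `hU`, Arapura `hA`, R-HD `hHD`, `hI` only.  Ingredients: `frameIso 𝔣 ((g γ̃)^{τ₁}) = g^𝔣 · ballRep 𝔣 γ̃` (`frameIso_cosetRealPoint`); the
group isomorphism `Γ ≃* Δ` (`ballRep` is injective) carries `N_g`, `Γ ∩ g⁻¹Γg` to `N := ballRep(N_g)`, `heckeStab Δ g^𝔣` (`map_heckeStabilizer_eq_heckeStab`) and the
index `[Γ ∩ g⁻¹Γg : N_g]` to `[heckeStab Δ g^𝔣 : N]` (`relIndex_map_map_of_injective`); the sum over `Γ/N_g` is re-indexed over `Δ/N` (`Quotient.congr`,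
representative-independence `factorPullback_mul_ballRep_of_mem_heckeLevel`); then sinst-1's normalisation identity and `[Γ':N_g] ≠ 0`.  This is the form in
which sinst-1's `WeightFormsHecke.toGroup_hecke` / `heckeW_restrictHom_apply` and `ThetaSpaceSatHeckeMoved` (#1234/#1235) read the right-hand side on adelic theta
forms — the (J2)/(J4) seam.  KIND: kernel theorem; nothing cited anew, nothing minted; 0 proof holes; expected `#print axioms` ⊆ {propext, Classical.choice, Quot.sound}.

References: G. Shimura (1971), §3.4 (3.4.1), §8.3 (8.3.2); A. Borel (1997), §5.13–5.14.
-/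

noncomputable section

open Matrix MulAction Function Set
open scoped TensorProduct
open CategoryTheory
open Literature.Geometry.ComplexHyperbolic
open Literature.Geometry.ComplexHyperbolic.BallModel (U21 Ball Jac)
open Literature.AlgebraicGeometry.HodgeTheory
open Literature.AlgebraicGeometry.Motives (SchemeOver ComplexPoints AlgPoints bettiCohomology IsSmoothProjective)
open Literature.NumberTheory.Transcendental (Arapura2012_Cor_15_4_6)
open Literature.NumberTheory.Automorphic.PicardCM (BallQuotientUniformisedDatum)
open Literature.NumberTheory.Automorphic.AutomorphyFactor

namespace HodgeCM.Model.HeckeClassLiftHecke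

open Literature.AlgebraicGeometry.ShimuraVarieties UnitaryBallQuotientDatum
open Literature.AlgebraicGeometry.ShimuraVarieties.UnitaryBallUniformisationDatum (ballRep_apply)
open Literature.AlgebraicGeometry.ShimuraVarieties.BallForms (factorPullback factorPullback_mul cotangentCocycle isPullbackCocycle_cotangentCocycle
  mem_factorForms_iff_factorPullback_eq)
open HodgeCM.BallFormsHecke (heckeStab mem_heckeStab_iff hecke sum_factorPullback_mul_out_eq_relIndex_smul_hecke factorPullback_mul_out_mk)
open HodgeCM.Model.HeckeAdmissible HodgeCM.Model.HeckeClassLift HodgeCM.Model.HeckeClassLiftRecords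

variable {X : SchemeOver ℂ} (D : UnitaryBallQuotientDatum 2 X) (𝔣 : D.SylvesterFrame) {g : GL (Fin 3) D.E}

/-! ### The rational element and the levels read in `U(2,1)` through the frame -/

/-- **`g^𝔣 := frameIso 𝔣 (g^{τ₁}) ∈ U(2,1)`**: the rational isometry `g ∈ U(V)(F)` read in the Sylvester frame. [cite: BergeronMillsonMoeglin2016Balls, Part 2 §1.1] -/
def ballElt (hg : g ∈ unitaryGroup (conjRingHom D.E) D.H) : U21 :=
  D.frameIso 𝔣 ⟨Matrix.GeneralLinearGroup.map D.τ₁ g, D.map_τ₁_mem_realPoints hg⟩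

/-- `frameIso 𝔣 ((g γ̃)^{τ₁}) = g^𝔣 · ballRep 𝔣 γ̃`. [folklore] -/
theorem frameIso_cosetRealPoint (h : D.IsHeckeAdmissible g) (γ : ↥D.Γ) :
    D.frameIso 𝔣 (cosetRealPoint h γ) = ballElt D 𝔣 h.mem_unitaryGroup * D.ballRep 𝔣 γ := by
  rw [ballRep_apply, ballElt, ← map_mul]
  rfl

/-- The image of `Γ ∩ g⁻¹Γg` in `U(2,1)` is sinst-1's `heckeStab Δ g^𝔣` of `Δ = ballImage 𝔣`. [cite: Shimura1973, §3.1] -/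
theorem map_heckeStabilizer_eq_heckeStab (hg : g ∈ unitaryGroup (conjRingHom D.E) D.H) :
    (D.heckeStabilizer g).map (D.ballRep 𝔣) = heckeStab (D.ballImage 𝔣) (ballElt D 𝔣 hg) := by
  ext u
  constructor
  · intro hu
    obtain ⟨γ, hγ, rfl⟩ := Subgroup.mem_map.1 hu
    rw [mem_heckeStab_iff]
    refine ⟨Subgroup.mem_map_of_mem _ (Subgroup.mem_top γ), ?_⟩
    rw [mem_heckeStabilizer_iff] at hγ
    refine Subgroup.mem_map.2 ⟨⟨_, hγ⟩, Subgroup.mem_top _, ?_⟩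
    rw [ballRep_apply, ballRep_apply, ballElt, ← map_mul, ← map_inv, ← map_mul]
    rfl
  · intro hu
    obtain ⟨hu₁, hconj⟩ := mem_heckeStab_iff.1 hu
    obtain ⟨γ, -, rfl⟩ := Subgroup.mem_map.1 hu₁
    obtain ⟨γ', -, hγ'⟩ := Subgroup.mem_map.1 hconj
    refine Subgroup.mem_map.2 ⟨γ, ?_, rfl⟩
    rw [mem_heckeStabilizer_iff]
    -- `ballRep γ' = g^𝔣 (ballRep γ) (g^𝔣)⁻¹ = frameIso ((g γ g⁻¹)^{τ₁})`, and `frameIso`, `GL.map τ₁` are injective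
    have hinj : Matrix.GeneralLinearGroup.map D.τ₁ (g * (γ : GL (Fin 3) D.E) * g⁻¹) = Matrix.GeneralLinearGroup.map D.τ₁ (γ' : GL (Fin 3) D.E) := by
      have h1 : D.frameIso 𝔣 ⟨Matrix.GeneralLinearGroup.map D.τ₁ (g * (γ : GL (Fin 3) D.E) * g⁻¹),
          D.map_τ₁_mem_realPoints (mul_mem (mul_mem hg (D.isCongruenceSubgroup.1 γ.2)) (inv_mem hg))⟩ =
          ballElt D 𝔣 hg * D.ballRep 𝔣 γ * (ballElt D 𝔣 hg)⁻¹ := by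
        rw [ballRep_apply, ballElt, ← map_mul, ← map_inv, ← map_mul]
        rfl
      rw [← hγ', ballRep_apply] at h1
      exact congrArg (fun u : D.realPoints ↦ (u : GL (Fin 3) ℂ)) ((D.frameIso 𝔣).injective h1)
    have hinj' : g * (γ : GL (Fin 3) D.E) * g⁻¹ = (γ' : GL (Fin 3) D.E) := by
      apply Units.ext
      exact Matrix.map_injective D.τ₁.injective (congrArg (fun u : GL (Fin 3) ℂ ↦ (u : Matrix (Fin 3) (Fin 3) ℂ)) hinj)
    rw [hinj']
    exact γ'.2

/-- The holomorphic lift of a class is a `Δ`-form for the cotangent cocycle. [cite: Borel1997, §5.14] -/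
theorem classLift_mem_factorForms (hHD : exists_isReal_hodgeModel) (c : ℂ ⊗[ℚ] bettiCohomology X 1) :
    D.classLift hHD 𝔣 c ∈ factorForms (D.ballImage 𝔣) cotangentCocycle :=
  (BallForms.mem_holFactorForms_iff.mp
    (D.toUnitaryBallUniformisationDatum.holFormPullback₁ (stdModel hHD D.isSmoothProjective) 𝔣 ⊤
      ((stdModel hHD D.isSmoothProjective).oneFormOfClassSurface D.isSmoothProjective c)).2).1

/-- Representative-independence: `(g^𝔣 · ballRep (γ n))^* F = (g^𝔣 · ballRep γ)^* F` for `n ∈ N_g` and a `Δ`-form `F` (`g (γ n γ⁻¹) g⁻¹ ∈ Γ`).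
[folklore] -/
theorem factorPullback_mul_ballRep_of_mem_heckeLevel (hg : g ∈ unitaryGroup (conjRingHom D.E) D.H) {F : Ball → (Fin 2 → ℂ)}
    (hF : F ∈ factorForms (D.ballImage 𝔣) cotangentCocycle) (γ : ↥D.Γ) {n : ↥D.Γ} (hn : n ∈ D.heckeLevel g) :
    factorPullback cotangentCocycle (ballElt D 𝔣 hg * D.ballRep 𝔣 (γ * n)) F = factorPullback cotangentCocycle (ballElt D 𝔣 hg * D.ballRep 𝔣 γ) F := by
  rw [map_mul, ← mul_assoc, factorPullback_mul isPullbackCocycle_cotangentCocycle]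
  -- `(g^𝔣 ballRep γ)^* F` is a form for a group containing `ballRep n`
  have hF' : factorPullback cotangentCocycle (ballElt D 𝔣 hg * D.ballRep 𝔣 γ) F ∈
      factorForms ((D.heckeLevel g).map (D.ballRep 𝔣)) cotangentCocycle := by
    refine BallForms.factorPullback_mem_factorForms isPullbackCocycle_cotangentCocycle hF fun δ hδ ↦ ?_
    obtain ⟨m, hm, rfl⟩ := hδ
    -- `g (γ m γ⁻¹) g⁻¹ ∈ Γ`
    have hconj : g * ((γ * m * γ⁻¹ : ↥D.Γ) : GL (Fin 3) D.E) * g⁻¹ ∈ D.Γ :=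
      D.conj_mem_of_mem_heckeLevel g (Subgroup.Normal.conj_mem inferInstance m hm γ)
    refine Subgroup.mem_map.2 ⟨⟨_, hconj⟩, Subgroup.mem_top _, ?_⟩
    rw [ballRep_apply, ballRep_apply, ballRep_apply, ballElt, ← map_mul, ← map_mul, ← map_inv, ← map_mul]
    congr 1
    apply Subtype.ext
    change Matrix.GeneralLinearGroup.map D.τ₁ (g * ((γ * m * γ⁻¹ : ↥D.Γ) : GL (Fin 3) D.E) * g⁻¹) = _
    simp only [map_mul, map_inv, Subgroup.coe_mul, InvMemClass.coe_inv]
    change _ = ((Matrix.GeneralLinearGroup.map D.τ₁ g * (D.toRealPoints γ : GL (Fin 3) ℂ)) * (D.toRealPoints m : GL (Fin 3) ℂ) *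
      (Matrix.GeneralLinearGroup.map D.τ₁ g * (D.toRealPoints γ : GL (Fin 3) ℂ))⁻¹ : GL (Fin 3) ℂ)
    have hγ : ((D.toRealPoints γ : D.realPoints) : GL (Fin 3) ℂ) = Matrix.GeneralLinearGroup.map D.τ₁ (γ : GL (Fin 3) D.E) := rfl
    have hm' : ((D.toRealPoints m : D.realPoints) : GL (Fin 3) ℂ) = Matrix.GeneralLinearGroup.map D.τ₁ (m : GL (Fin 3) D.E) := rfl
    rw [hγ, hm']
    group
  exact (mem_factorForms_iff_factorPullback_eq.mp hF') _ (Subgroup.mem_map_of_mem _ hn)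

/-! ### The main identity -/

/-- **(J2) in Hecke normal form**: for every compact ball quotient surface datum `D`, frame `𝔣`, `g ∈ U(V)(F)` and `ω ∈ F¹H¹(X)`,
`classLift 𝔣 (T_g ω) = T_{g^𝔣} (classLift 𝔣 ω)` with sinst-1's `BallFormsHecke.hecke` on the right (the finite index of `Δ ∩ (g^𝔣)⁻¹Δ g^𝔣` in `Δ` being that
of `Γ ∩ g⁻¹Γg` in `Γ`). [cite: Shimura1973, §8.3] [cite: Borel1997, §5.13–5.14] -/
theorem classLift_heckeOpC_eq_hecke (hU : BallQuotientUniformisedDatum) (hA : Arapura2012_Cor_15_4_6) (hHD : exists_isReal_hodgeModel)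
    (hI : hodgePQ_independent_of_hodgeModel) (hg : g ∈ unitaryGroup (conjRingHom D.E) D.H)
    [Fintype (↥(D.ballImage 𝔣) ⧸ (heckeStab (D.ballImage 𝔣) (ballElt D 𝔣 hg)).subgroupOf (D.ballImage 𝔣))]
    {ω : ℂ ⊗[ℚ] bettiCohomology X 1} (hω : ω ∈ (BettiUniverse.hodge hHD D.isSmoothProjective 1).F 1) :
    D.classLift hHD 𝔣 (heckeOpC D D.isSmoothProjective 1 g ω) =
      hecke cotangentCocycle (D.ballImage 𝔣) (ballElt D 𝔣 hg) (D.classLift hHD 𝔣 ω) := by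
  have h : D.IsHeckeAdmissible g := isHeckeAdmissible D hU hg
  haveI : (D.heckeLevel g).FiniteIndex := h.finiteIndex
  letI : Fintype (↥D.Γ ⧸ D.heckeLevel g) := Subgroup.fintypeQuotientOfFiniteIndex
  have hmain := HeckeClassLiftRecords.classLift_heckeOpC D hU hA hHD hI 𝔣 hg hω
  rw [hmain]
  set F := D.classLift hHD 𝔣 ω with hFdef
  have hF : F ∈ factorForms (D.ballImage 𝔣) cotangentCocycle := classLift_mem_factorForms D 𝔣 hHD ω
  -- the image level `N = ballRep(N_g) ≤ heckeStab Δ g^𝔣`, normal in `Δ`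
  set N : Subgroup U21 := (D.heckeLevel g).map (D.ballRep 𝔣) with hNdef
  have hNle : N ≤ heckeStab (D.ballImage 𝔣) (ballElt D 𝔣 hg) := by
    rw [hNdef, ← map_heckeStabilizer_eq_heckeStab D 𝔣 hg]
    exact Subgroup.map_mono (D.heckeLevel_le g)
  -- the isomorphism `Γ ≃* Δ`
  let e : ↥D.Γ ≃* ↥(D.ballImage 𝔣) := Subgroup.topEquiv.symm.trans (Subgroup.equivMapOfInjective ⊤ (D.ballRep 𝔣) (D.ballRep_injective 𝔣))
  have he : ∀ γ : ↥D.Γ, ((e γ : ↥(D.ballImage 𝔣)) : U21) = D.ballRep 𝔣 γ := fun γ ↦ rfl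
  have hNe : (D.heckeLevel g).map e.toMonoidHom = N.subgroupOf (D.ballImage 𝔣) := by
    ext δ
    rw [Subgroup.mem_subgroupOf, hNdef, Subgroup.mem_map, Subgroup.mem_map]
    constructor
    · rintro ⟨γ, hγ, rfl⟩
      exact ⟨γ, hγ, (he γ).symm⟩
    · rintro ⟨γ, hγ, hγδ⟩
      refine ⟨γ, hγ, Subtype.ext ?_⟩
      rw [← hγδ]
      exact he γ
  haveI hNnormal : (N.subgroupOf (D.ballImage 𝔣)).Normal := by
    rw [← hNe]
    exact Subgroup.Normal.map inferInstance e.toMonoidHom e.surjective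
  -- the index sets correspond
  let qe : (↥D.Γ ⧸ D.heckeLevel g) ≃ (↥(D.ballImage 𝔣) ⧸ N.subgroupOf (D.ballImage 𝔣)) :=
    Quotient.congr e.toEquiv fun a b ↦ by
      rw [QuotientGroup.leftRel_apply, QuotientGroup.leftRel_apply]
      change a⁻¹ * b ∈ D.heckeLevel g ↔ (e a)⁻¹ * e b ∈ N.subgroupOf (D.ballImage 𝔣)
      rw [← map_inv, ← map_mul, ← hNe]
      constructor
      · exact fun hab ↦ Subgroup.mem_map_of_mem (e.toMonoidHom) hab
      · intro hmem
        obtain ⟨x, hx, hxe⟩ := Subgroup.mem_map.1 hmem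
        have hx' : x = a⁻¹ * b := e.injective hxe
        exact hx' ▸ hx
  letI : Fintype (↥(D.ballImage 𝔣) ⧸ N.subgroupOf (D.ballImage 𝔣)) := Fintype.ofEquiv _ qe
  -- re-index the sum of #R100 over `Δ / N`
  have hsum : ∑ q : ↥D.Γ ⧸ D.heckeLevel g, factorPullback cotangentCocycle (D.frameIso 𝔣 (cosetRealPoint h (Quotient.out q))) F =
      ∑ q : ↥(D.ballImage 𝔣) ⧸ N.subgroupOf (D.ballImage 𝔣), factorPullback cotangentCocycle (ballElt D 𝔣 hg * (((Quotient.out q : ↥(D.ballImage 𝔣))) : U21)) F := by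
    refine Fintype.sum_equiv qe _ _ fun q ↦ ?_
    induction q using QuotientGroup.induction_on with
    | H γ =>
      rw [frameIso_cosetRealPoint]
      -- left representative: `out (mk γ) = γ n`, `n ∈ N_g`
      obtain ⟨n, hn, hout⟩ : ∃ n ∈ D.heckeLevel g, Quotient.out (QuotientGroup.mk γ : ↥D.Γ ⧸ D.heckeLevel g) = γ * n := by
        refine ⟨γ⁻¹ * Quotient.out (QuotientGroup.mk γ : ↥D.Γ ⧸ D.heckeLevel g), ?_, by group⟩
        exact QuotientGroup.leftRel_apply.mp (Quotient.exact (Quotient.out_eq (QuotientGroup.mk γ : ↥D.Γ ⧸ D.heckeLevel g)).symm)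
      rw [hout, factorPullback_mul_ballRep_of_mem_heckeLevel D 𝔣 hg hF γ hn]
      -- right representative: sinst-1's representative-independence on the `Δ` side
      have hqe : qe (QuotientGroup.mk γ) = (QuotientGroup.mk (e γ) : ↥(D.ballImage 𝔣) ⧸ N.subgroupOf (D.ballImage 𝔣)) := Quotient.congr_mk _ _ γ
      rw [hqe, factorPullback_mul_out_mk isPullbackCocycle_cotangentCocycle hNle hF (e γ), he]
  rw [hsum, sum_factorPullback_mul_out_eq_relIndex_smul_hecke (R := ℂ) isPullbackCocycle_cotangentCocycle hNle hF, smul_smul]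
  -- the indices agree: `[heckeStab Δ g^𝔣 : N] = [Γ ∩ g⁻¹Γg : N_g] = heckeIndex g ≠ 0`
  have hidx : N.relIndex (heckeStab (D.ballImage 𝔣) (ballElt D 𝔣 hg)) = D.heckeIndex g := by
    rw [hNdef, ← map_heckeStabilizer_eq_heckeStab D 𝔣 hg, Subgroup.relIndex_map_map_of_injective _ _ (D.ballRep_injective 𝔣)]
    rfl
  have hne : (D.heckeIndex g : ℂ) ≠ 0 := by
    have : D.heckeIndex g ≠ 0 := (Subgroup.instFiniteIndex_subgroupOf (D.heckeLevel g) (D.heckeStabilizer g)).index_ne_zero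
    exact_mod_cast this
  rw [hidx, inv_mul_cancel₀ hne, one_smul]

end HodgeCM.Model.HeckeClassLiftHecke

end
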